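import Summits.BirchSwinnertonDyer.BirchSwinnertonDyer.Theorems.ManinLocalTwoThreeManinOddAtFourEtaTwo
import Summits.BirchSwinnertonDyer.Rank1Residual.ManinAdditive.TwistOrbitAtTwoA4ExactAtTwo
import HarnessLib

/-!
# Crux `ManinOddAtFour` (route `ManinLocalTwoThree`, cell `bsd-f2-manin`), corollary of `stub_etaTwo`:
# EXACT Manin / degree transport between the `χ₈`- and `χ₋₈`-twists of ANY class semistable at `2`
# (E-an-21 with Stevens' `η`-clause removed)

Helper file (prover seat `bsd-line-manin23-p3`) for the crux item stmt-BirchSwinnertonDyer-22967. The tree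
leaf E-an-21 `ExactManinTransportOfTwistsOfSemistableAtTwo` (planner `bsd-f2-manin-an`, MEMO-an §39;
`exactManinTransportOfTwistsOfSemistableAtTwo_holds`) proves: for `W₁` semistable at `2` IN A CASE `η = 1`
(`2 ∣ N(W₁)` or `a₂(W₁)` odd), the lattice-optimal data `D`, `D′` of the globally minimal members
`W ∼ W₁ ⊗ χ₈`, `W′ ∼ W₁ ⊗ χ₋₈` of the same conductor on a commuting `χ₋₄`-orbit (`u • (W ⊗ χ₋₄) = W′`,
`Δ′ = Δ`) have `c′ = ±c` and EQUAL modular degrees. MEMO-an §39 RESIDUE: «`η = 2` (`W₁` good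
supersingular at `2`): exact transport ⟸ E-an-1». With E-an-1 now a theorem
(`twoNotDvdManinOfTwistEtaTwo_holds`, FILE 3), the `η`-clause is dropped here: BOTH `c` and `c′` are odd in
every case, and the two-sided lattice chain `c′ ∣ 2c`, `c ∣ 2c′` (`evenCommuting_negOne`) forces `|c′| = |c|`,
whence `deg′ = deg` (`negOneCommutingOrbitDegreeTrichotomy_holds`). Beyond print (ref2 R-an-10/12: no
factor-free transport at additive `2` in print); BSD is not proved by this.

References: [cite: Stevens1989, Lemmas (5.2), (5.4) and (5.6)–(5.7)] [cite: Watkins2002, §2.1]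
[cite: Cesnavicius2018, Thm. 1.2] [cite: Pal2012, Lemma 3.1]
-/

set_option autoImplicit false
set_option linter.dupNamespace false

noncomputable section

open scoped MatrixGroups ModularForm

open CongruenceSubgroup WeierstrassCurve Literature.NumberTheory.EllipticCurves
  Literature.NumberTheory.EllipticCurves.ModularForms Summit.BirchSwinnertonDyer.Rank1Residual.ManinAdditive

namespace Summit.BirchSwinnertonDyer.BirchSwinnertonDyer.Theorems

/-- **Exact Manin transport at `2` for EVERY pair of `χ_{±8}`-twists of a class semistable at `2`**
(E-an-21 without the `η`-clause): `W₁` globally minimal with `4 ∤ N(W₁)`; `W ∼ W₁ ⊗ χ₈`, `W′ ∼ W₁ ⊗ χ₋₈`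
globally minimal of the same conductor `N` with `N(W₁) ∣ N`, `8² ∣ N`; `u • (W ⊗ χ₋₄) = W′`, `Δ(W′) = Δ(W)`;
`D`, `D′` lattice-optimal `X₀(N)`-data. Then `c(D′) = ±c(D)` and `deg φ′ = deg φ` (modulo the printed facts
`hM hAU hC2 hnf`). Case `η = 1`: the tree's E-an-21; case `η = 2` (`W₁` good at `2`, `a₂` even): E-an-1 twice
+ the `χ₋₄` lattice chain. [cite: Stevens1989, Lemmas (5.2), (5.4), (5.6)–(5.7)] [cite: Watkins2002, §2.1] -/
theorem exactManinTransport_of_twists_of_semistableAtTwo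
    (hM : mazur_not_dvd_maninConstant_of_odd)
    (hAU : abbesUllmo_not_dvd_maninConstant_of_not_dvd_level)
    (hC2 : cesnavicius_not_two_dvd_maninConstant_of_two_dvd_level) (hnf : exists_isNewformOf)
    (W₁ : WeierstrassCurve ℚ) [W₁.IsElliptic] [W₁.IsGloballyMinimal]
    (W W' : WeierstrassCurve ℚ) [W.IsElliptic] [W.IsGloballyMinimal] [W'.IsElliptic]
    [W'.IsGloballyMinimal] [NeZero (W.conductorNorm ℤ)] [NeZero (W'.conductorNorm ℤ)]
    (u : VariableChange ℚ) (D : ModularParametrizationData W (W.conductorNorm ℤ))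
    (D' : ModularParametrizationData W' (W'.conductorNorm ℤ))
    (h4N₁ : ¬ 2 ^ 2 ∣ W₁.conductorNorm ℤ)
    (htw : WeierstrassCurve.IsIsogenous W (W₁.quadraticTwist ((2 : ℤ) : ℚ)))
    (htw' : WeierstrassCurve.IsIsogenous W' (W₁.quadraticTwist ((-2 : ℤ) : ℚ)))
    (hN₁N : W₁.conductorNorm ℤ ∣ W.conductorNorm ℤ) (h64 : 8 ^ 2 ∣ W.conductorNorm ℤ)
    (hN : W'.conductorNorm ℤ = W.conductorNorm ℤ) (hu : u • W.quadraticTwist (-1 : ℚ) = W')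
    (hΔ : W'.Δ = W.Δ)
    (hD : ∀ z ∈ D.L.lattice, ∃ w ∈ periodLattice D.f, z = D.c * w)
    (hD' : ∀ z ∈ D'.L.lattice, ∃ w ∈ periodLattice D'.f, z = D'.c * w) :
    (D'.c = D.c ∨ D'.c = -D.c) ∧ D'.modularDegree = D.modularDegree := by
  by_cases hη : 2 ∣ W₁.conductorNorm ℤ ∨ Odd (W₁.LFunction 2)
  · exact exactManinTransportOfTwistsOfSemistableAtTwo_holds hM hAU hC2 hnf W₁ W W' u D D' h4N₁ hη htw
      htw' hN₁N h64 hN hu hΔ hD hD'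
  -- `η = 2`: `W₁` is good at `2` with `a₂` even
  rw [not_or] at hη
  have hgood : W₁.HasGoodReductionAtPrime 2 :=
    hasGoodReductionAtPrime_two_of_not_two_dvd_conductorNorm W₁ hη.1
  have hss : Even (W₁.LFunction 2) := Int.not_odd_iff_even.mp hη.2
  have h64' : 8 ^ 2 ∣ W'.conductorNorm ℤ := by rw [hN]; exact h64
  have hN₁N' : W₁.conductorNorm ℤ ∣ W'.conductorNorm ℤ := by rw [hN]; exact hN₁N
  have h4 : 2 ^ 2 ∣ W.conductorNorm ℤ := dvd_trans (by norm_num) h64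
  have h4' : 2 ^ 2 ∣ W'.conductorNorm ℤ := dvd_trans (by norm_num) h64'
  have h16 : 4 ^ 2 ∣ W.conductorNorm ℤ := dvd_trans (by norm_num) h64
  have hadd := not_good_and_not_mult_of_sq_dvd_conductorNorm W h4
  have hadd' := not_good_and_not_mult_of_sq_dvd_conductorNorm W' h4'
  have hmN : (4 * (2 : ℤ).natAbs) ^ 2 ∣ W.conductorNorm ℤ := by simpa using h64
  have hmN' : (4 * (-2 : ℤ).natAbs) ^ 2 ∣ W'.conductorNorm ℤ := by simpa using h64'
  have hodd : ¬ (2 : ℤ) ∣ D.c :=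
    twoNotDvdManinOfTwistEtaTwo_holds hM hAU hC2 hnf (Or.inl rfl) htw hN₁N hmN hgood hss hadd W D
      (WeierstrassCurve.isIsogenous_self W) hD
  have hodd' : ¬ (2 : ℤ) ∣ D'.c :=
    twoNotDvdManinOfTwistEtaTwo_holds hM hAU hC2 hnf (Or.inr rfl) htw' hN₁N' hmN' hgood hss hadd' W' D'
      (WeierstrassCurve.isIsogenous_self W') hD'
  have hu' : u • W.quadraticTwist (((-1 : ℤ) : ℤ) : ℚ) = W' := by simpa using hu
  have hΔ' : W'.Δ = (((-1 : ℤ) : ℤ) : ℚ) ^ 6 * W.Δ := by rw [hΔ]; norm_num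
  obtain ⟨h1, h2⟩ := evenCommuting_negOne.2 W W' u D D' h16 hN hu' hD hD' hΔ'
  have h2n : D.c ∣ 2 * (-D'.c) := by
    rw [show (2 : ℤ) * (-1 : ℤ) * D'.c = 2 * (-D'.c) by ring] at h2; exact h2
  have hg' : Int.gcd D'.c 2 = 1 :=
    Int.isCoprime_iff_gcd_eq_one.mp (Int.prime_two.irreducible.coprime_iff_not_dvd.mpr hodd').symm
  have hg : Int.gcd D.c 2 = 1 :=
    Int.isCoprime_iff_gcd_eq_one.mp (Int.prime_two.irreducible.coprime_iff_not_dvd.mpr hodd).symm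
  have h1' : D'.c ∣ D.c := Int.dvd_of_dvd_mul_right_of_gcd_one h1 hg'
  have h2' : D.c ∣ D'.c := dvd_neg.mp (Int.dvd_of_dvd_mul_right_of_gcd_one h2n hg)
  have habs : D'.c.natAbs = D.c.natAbs := Int.natAbs_eq_of_dvd_dvd h1' h2'
  have hcc : D'.c = D.c ∨ D'.c = -D.c := Int.natAbs_eq_natAbs_iff.mp habs
  refine ⟨hcc, ?_⟩
  have hsq : D'.c ^ 2 = D.c ^ 2 := by rcases hcc with h | h <;> simp [h]
  exact (negOneCommutingOrbitDegreeTrichotomy_holds W W' u D D' h16 hN hu hD hD' hΔ).2.mpr hsq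

end Summit.BirchSwinnertonDyer.BirchSwinnertonDyer.Theorems

end
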